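import Literature.Analysis.FluidPDE.DipolePotentialFlow
import Literature.Analysis.FluidPDE.ClassicalSolution
import Mathlib.Analysis.Calculus.Deriv.Abs
import HarnessLib

/-!
# Serrin's example: the potential flows `u = a(t)∇θ(x)` solve Navier–Stokes for EVERY amplitude `a` —
# spatial smoothness of an exact solution implies no regularity in time

Analysis/FluidPDE proofs-layer file (theorems + data definitions, NO new `Prop` facts) over the tree's
`convect` / `VectorCalculus.divergence` (`VectorCalculus.lean`), the potential-flow calculus of
`DipolePotentialFlow.lean` (`convect_gradient_self`, `laplacian_gradient_eq_zero`, `hasFDerivAt_gradient`),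
`divergence_gradient` (`PressurePoisson.lean`) and the slab predicate `IsClassicalNSSolutionOn`
(`ClassicalSolution.lean`).

**Serrin 1962.** Let `θ : ℝ³ → ℝ` be harmonic (`Δθ = 0`) and `a : ℝ → ℝ` ANY amplitude. Then
`u(t,x) = a(t)∇θ(x)`, `p(t,x) = −a'(t)θ(x) − a(t)²|∇θ(x)|²/2` satisfy, at every `(t, x)` where `a` is differentiable
(with derivative `a'(t)`), the incompressible Navier–Stokes system with zero force and ANY viscosity `ν`:
`∂ₜu + (u·∇)u = νΔu − ∇p`, `div u = 0` — because `∂ₜu = a'∇θ`, `(u·∇)u = a²∇(½|∇θ|²)` (Bernoulli), `Δu = a∇Δθ = 0`,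
`div u = aΔθ = 0`. The velocity is `C^∞` in `x` at each fixed time as soon as `θ` is, while `t ↦ u(t, x)` has EXACTLY
the regularity of `a` at every `x` with `∇θ(x) ≠ 0` (`contDiffAt_serrinFlow_time_iff`): the equations force no time
regularity whatsoever on a spatially smooth exact solution — the pressure absorbs it ("the pressure … does not obey an
evolutionary PDE", Tao 2013, footnote to Thm. 1.12). This is the example behind the local regularity theory's
space/time asymmetry (Serrin 1962; Robinson–Rodrigo–Sadowski 2016, Example 13.2 and §13.5; Seregin 2014, §4.6:
"there is no smoothing in time despite the smoothness of f").

## Main statements (all proved)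

* `serrinFlow θ a`, `serrinPressure θ a a'` — the pair `(u, p)` (data definitions).
* `divergence_serrinFlow_eq_zero` — `div u(t,·) = 0` (`θ ∈ C²` harmonic).
* `serrinFlow_momentum` — the momentum equation at `(t, x)` for every `ν`, given `HasDerivAt a (a' t) t`
  (`θ ∈ C³` harmonic).
* `contDiff_serrinFlow_space` — `u(t, ·) ∈ C^∞` for every `t` (`θ ∈ C^∞`), no hypothesis on `a`.
* `contDiffAt_serrinFlow_time_iff`, `differentiableAt_serrinFlow_time_iff` — at a point with `∇θ(x) ≠ 0`,
  `t ↦ u(t, x)` is `Cⁿ` (resp. differentiable) at `t₀` iff `a` is.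
* `isClassicalNSSolutionOn_serrinFlow` — positive side: for `a ∈ C^∞` the pair IS a classical solution on
  `ℝ × ℝ³` (zero force, any `ν`).
* `not_isSmoothSpaceTimeOn_serrinFlow` — negative side: if `a` is not `C^∞` at some `t₀` and `∇θ` does not vanish
  identically, `u` is not jointly smooth on any time set containing a neighbourhood of `t₀`, hence
  (`not_isClassicalNSSolutionOn_serrinFlow`) not a classical solution there for ANY pressure, force and viscosity —
  although it satisfies the equations pointwise whenever `a` is differentiable.
* A concrete witness: `cuspAmp t = t|t|` is differentiable everywhere with derivative `2|t|`
  (`hasDerivAt_cuspAmp`) and not `C²` at `0` (`not_contDiffAt_two_cuspAmp`); with the harmonic coordinate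
  `θ = x₀` (`gradient_coord_zero`, `laplacian_coord_zero`) the flow `t|t| e₀` with pressure `−2|t| x₀` satisfies
  Navier–Stokes at EVERY point of `ℝ × ℝ³` (`serrinWitness_momentum`, `serrinWitness_divergence`), is `C^∞` in
  `x`, and is not `C²` in `t` at `t = 0` (`serrinWitness_not_contDiffAt_two`).

## What is NOT here

Finite energy: a non-constant harmonic `θ` on `ℝ³` has `∇θ ∉ L²`, so these are LOCAL (infinite-energy) solutions —
Serrin's example lives in a bounded domain; the finite-energy version of the phenomenon at `t = 0` is Tao 2013,
Thm. 1.12 (smooth `H¹` data with no smooth solution), not formalised here. Weak formulations are not touched.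

## References

* J. Serrin, *On the interior regularity of weak solutions of the Navier–Stokes equations*, Arch. Rational Mech.
  Anal. 9 (1962) 187–195 (the example `u = a(t)∇h`). [Serrin1962]
* J. C. Robinson, J. L. Rodrigo, W. Sadowski, *The Three-Dimensional Navier–Stokes Equations*, CUP 2016,
  Example 13.2 ("Serrin's example") and §13.5. [RobinsonRodrigoSadowski2016]
* G. Seregin, *Lecture Notes on Regularity Theory for the Navier–Stokes Equations*, World Scientific 2014, §4.6
  (the example `u = c(t)∇h`, `p = −c'(t)h`). [Seregin2014]
* T. Tao, *Localisation and compactness properties of the Navier–Stokes global regularity problem*, Anal. PDE 6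
  (2013), Thm. 1.12 and §15. [Tao2011]
-/

noncomputable section

open Set Filter Function
open scoped Topology InnerProductSpace RealInnerProductSpace Laplacian ContDiff

namespace Literature.Analysis.FluidPDE

local notation "ℝ³" => EuclideanSpace ℝ (Fin 3)

/-! ## The flow and its pressure -/

/-- SERRIN'S POTENTIAL FLOW `u(t, x) = a(t) ∇θ(x)` (`θ` harmonic, `a` an arbitrary amplitude).
[cite: Serrin1962, the example u = a(t)∇h] -/
def serrinFlow (θ : ℝ³ → ℝ) (a : ℝ → ℝ) : ℝ → ℝ³ → ℝ³ := fun t x => a t • gradient θ x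

/-- Its Bernoulli pressure `p(t, x) = −a'(t) θ(x) − a(t)² |∇θ(x)|²/2` (`a'` = the derivative of `a`, supplied as a
function). [cite: Serrin1962, the example u = a(t)∇h] -/
def serrinPressure (θ : ℝ³ → ℝ) (a a' : ℝ → ℝ) : ℝ → ℝ³ → ℝ :=
  fun t x => -(a' t) * θ x - (a t) ^ 2 * (2⁻¹ * ‖gradient θ x‖ ^ 2)

/-- Unfolding lemma for the flow. [folklore] -/
@[simp] private theorem serrinFlow_apply (θ : ℝ³ → ℝ) (a : ℝ → ℝ) (t : ℝ) (x : ℝ³) :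
    serrinFlow θ a t x = a t • gradient θ x := rfl

/-- Unfolding lemma for the pressure. [folklore] -/
private theorem serrinPressure_apply (θ : ℝ³ → ℝ) (a a' : ℝ → ℝ) (t : ℝ) (x : ℝ³) :
    serrinPressure θ a a' t x = -(a' t) * θ x - (a t) ^ 2 * (2⁻¹ * ‖gradient θ x‖ ^ 2) := rfl

/-! ## Calculus of the gradient field -/

/-- The gradient field of a `Cⁿ⁺¹` potential is `Cⁿ` (Riesz composed with `Dθ`). [folklore] -/
private theorem contDiff_gradient_of_succ' {θ : ℝ³ → ℝ} {n : ℕ∞} (hθ : ContDiff ℝ ((n : WithTop ℕ∞) + 1) θ) :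
    ContDiff ℝ n (gradient θ) := by
  have e : gradient θ = fun x => (InnerProductSpace.toDual ℝ ℝ³).symm (fderiv ℝ θ x) := rfl
  rw [e]
  exact (InnerProductSpace.toDual ℝ ℝ³).symm.contDiff.comp (hθ.fderiv_right le_rfl)

/-- The gradient field of a `C^∞` potential is `C^∞`. [folklore] -/
private theorem contDiff_gradient_of_top' {θ : ℝ³ → ℝ} (hθ : ContDiff ℝ ∞ θ) : ContDiff ℝ ∞ (gradient θ) := by
  have e : gradient θ = fun x => (InnerProductSpace.toDual ℝ ℝ³).symm (fderiv ℝ θ x) := rfl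
  rw [e]
  exact (InnerProductSpace.toDual ℝ ℝ³).symm.contDiff.comp (contDiff_infty_iff_fderiv.1 hθ).2

/-! ## The equations -/

/-- **Incompressibility**: `div u(t, ·) = a(t) Δθ = 0` at every point where `Δθ = 0` (`θ ∈ C²`).
[cite: Serrin1962, the example u = a(t)∇h] -/
theorem divergence_serrinFlow_eq_zero {θ : ℝ³ → ℝ} (hθ : ContDiff ℝ 2 θ) (a : ℝ → ℝ) (t : ℝ) {x : ℝ³}
    (hΔ : Δ θ x = 0) : VectorCalculus.divergence (serrinFlow θ a t) x = 0 := by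
  have hD : HasFDerivAt (gradient θ) (fderiv ℝ (gradient θ) x) x :=
    (hasFDerivAt_gradient hθ x).differentiableAt.hasFDerivAt
  rw [VectorCalculus.divergence, show serrinFlow θ a t = (a t) • gradient θ from rfl,
    (hD.const_smul (a t)).fderiv, ContinuousLinearMap.toLinearMap_smul, map_smul,
    ← VectorCalculus.divergence, divergence_gradient hθ x, hΔ, smul_zero]

/-- Incompressibility in the tree's vocabulary: `u(t, ·)` is divergence-free for a globally harmonic `θ ∈ C²`.
[cite: Serrin1962, the example u = a(t)∇h] -/
theorem isDivFree_serrinFlow {θ : ℝ³ → ℝ} (hθ : ContDiff ℝ 2 θ) (hΔ : ∀ x, Δ θ x = 0) (a : ℝ → ℝ) (t : ℝ) :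
    VectorCalculus.IsDivFree (serrinFlow θ a t) :=
  fun x => divergence_serrinFlow_eq_zero hθ a t (hΔ x)

/-- **The momentum equation** `∂ₜu + (u·∇)u = νΔu − ∇p` (zero force, ANY viscosity `ν`) at every `(t, x)` at which
the amplitude is differentiable with derivative `a'(t)`: `∂ₜu = a'∇θ`, `(u·∇)u = a²∇(½|∇θ|²)` (Bernoulli,
`convect_gradient_self`), `Δu = a ∇Δθ = 0` (`laplacian_gradient_eq_zero`), `∇p = −a'∇θ − a²∇(½|∇θ|²)`. Here
`θ ∈ C³` is globally harmonic. [cite: Serrin1962, the example u = a(t)∇h] -/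
theorem serrinFlow_momentum {θ : ℝ³ → ℝ} (hθ : ContDiff ℝ 3 θ) (hΔ : ∀ x, Δ θ x = 0) {a a' : ℝ → ℝ} {t : ℝ}
    (ha : HasDerivAt a (a' t) t) (ν : ℝ) (x : ℝ³) :
    deriv (fun s => serrinFlow θ a s x) t + convect (serrinFlow θ a t) (serrinFlow θ a t) x =
      ν • Δ (serrinFlow θ a t) x - gradient (serrinPressure θ a a' t) x := by
  have hθ2 : ContDiff ℝ 2 θ := hθ.of_le (by norm_num)
  have hθ1 : ContDiff ℝ 1 θ := hθ.of_le (by norm_num)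
  have hg := hasFDerivAt_gradient hθ2 x
  have hgd : DifferentiableAt ℝ (gradient θ) x := hg.differentiableAt
  have hD : HasFDerivAt (gradient θ) (fderiv ℝ (gradient θ) x) x := hgd.hasFDerivAt
  -- time derivative
  have h1 : deriv (fun s => serrinFlow θ a s x) t = a' t • gradient θ x :=
    (ha.smul_const (gradient θ x)).deriv
  -- convective term (Bernoulli)
  have h2 : convect (serrinFlow θ a t) (serrinFlow θ a t) x =
      (a t * a t) • gradient (fun y => 2⁻¹ * ‖gradient θ y‖ ^ 2) x := by
    rw [convect, show serrinFlow θ a t = (a t) • gradient θ from rfl, (hD.const_smul (a t)).fderiv,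
      FunLike.coe_smul, Pi.smul_apply, Pi.smul_apply, map_smul, smul_smul,
      ← convect_gradient_self hθ2 x, convect]
  -- viscous term
  have h3 : Δ (serrinFlow θ a t) x = 0 := by
    have hga : ContDiffAt ℝ 2 (gradient θ) x :=
      (contDiff_gradient_of_succ' (n := 2) (by exact_mod_cast hθ)).contDiffAt
    have h0 : Δ θ =ᶠ[𝓝 x] fun _ => (0 : ℝ) := Filter.Eventually.of_forall fun y => hΔ y
    show Δ ((a t) • gradient θ) x = 0
    rw [InnerProductSpace.laplacian_smul _ hga, laplacian_gradient_eq_zero hθ h0, smul_zero]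
  -- pressure gradient
  have hφd : DifferentiableAt ℝ (fun y => 2⁻¹ * ‖gradient θ y‖ ^ 2) x := (hgd.norm_sq ℝ).const_mul _
  have hθd : HasFDerivAt θ (fderiv ℝ θ x) x := (hθ1.differentiable one_ne_zero x).hasFDerivAt
  have hp : HasFDerivAt (serrinPressure θ a a' t)
      ((-(a' t)) • fderiv ℝ θ x - (a t) ^ 2 • fderiv ℝ (fun y => 2⁻¹ * ‖gradient θ y‖ ^ 2) x) x :=
    (hθd.const_mul (-(a' t))).sub (hφd.hasFDerivAt.const_mul ((a t) ^ 2))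
  have h4 : gradient (serrinPressure θ a a' t) x =
      (-(a' t)) • gradient θ x - (a t) ^ 2 • gradient (fun y => 2⁻¹ * ‖gradient θ y‖ ^ 2) x := by
    show (InnerProductSpace.toDual ℝ ℝ³).symm (fderiv ℝ (serrinPressure θ a a' t) x) = _
    rw [hp.fderiv, map_sub, map_smul, map_smul]
    rfl
  rw [h1, h2, h3, h4]
  simp only [smul_zero, zero_sub, neg_sub, neg_smul, sub_neg_eq_add, sq]
  abel

/-! ## Regularity: smooth in space, exactly as (ir)regular as `a` in time -/

/-- **Spatial smoothness**: for `θ ∈ C^∞`, every time slice `u(t, ·)` is `C^∞` — with NO hypothesis on the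
amplitude `a`. [cite: RobinsonRodrigoSadowski2016, Example 13.2] -/
theorem contDiff_serrinFlow_space {θ : ℝ³ → ℝ} (hθ : ContDiff ℝ ∞ θ) (a : ℝ → ℝ) (t : ℝ) :
    ContDiff ℝ ∞ (serrinFlow θ a t) :=
  (contDiff_gradient_of_top' hθ).const_smul (a t)

/-- Recovering the amplitude from the flow at a point with `∇θ(x) ≠ 0`:
`a(s) = ⟪u(s, x), ∇θ(x)⟫ / |∇θ(x)|²`. [folklore] -/
private theorem amp_eq_inner_serrinFlow {θ : ℝ³ → ℝ} {x : ℝ³} (hx : gradient θ x ≠ 0) (a : ℝ → ℝ) (s : ℝ) :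
    a s = (‖gradient θ x‖ ^ 2)⁻¹ * ⟪serrinFlow θ a s x, gradient θ x⟫ := by
  have hn : ‖gradient θ x‖ ^ 2 ≠ 0 := pow_ne_zero 2 (norm_ne_zero_iff.2 hx)
  rw [serrinFlow_apply, real_inner_smul_left, real_inner_self_eq_norm_sq]
  field_simp

/-- **Time regularity is exactly that of the amplitude**: at a point with `∇θ(x) ≠ 0`, `s ↦ u(s, x)` is `Cⁿ` at
`t` iff `a` is (`n ≤ ∞` or `ω`). [cite: RobinsonRodrigoSadowski2016, Example 13.2] -/
theorem contDiffAt_serrinFlow_time_iff {θ : ℝ³ → ℝ} {x : ℝ³} (hx : gradient θ x ≠ 0) (a : ℝ → ℝ) (t : ℝ)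
    (n : WithTop ℕ∞) : ContDiffAt ℝ n (fun s => serrinFlow θ a s x) t ↔ ContDiffAt ℝ n a t := by
  refine ⟨fun h => ?_, fun h => ?_⟩
  · have e : a = fun s => (‖gradient θ x‖ ^ 2)⁻¹ * ⟪serrinFlow θ a s x, gradient θ x⟫ :=
      funext (amp_eq_inner_serrinFlow hx a)
    rw [e]
    exact contDiffAt_const.mul (h.inner ℝ contDiffAt_const)
  · show ContDiffAt ℝ n (fun s => a s • gradient θ x) t
    exact h.smul contDiffAt_const

/-- Differentiable version: at a point with `∇θ(x) ≠ 0`, `s ↦ u(s, x)` is differentiable at `t` iff `a` is.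
[cite: RobinsonRodrigoSadowski2016, Example 13.2] -/
theorem differentiableAt_serrinFlow_time_iff {θ : ℝ³ → ℝ} {x : ℝ³} (hx : gradient θ x ≠ 0) (a : ℝ → ℝ)
    (t : ℝ) : DifferentiableAt ℝ (fun s => serrinFlow θ a s x) t ↔ DifferentiableAt ℝ a t := by
  refine ⟨fun h => ?_, fun h => ?_⟩
  · have e : a = fun s => (‖gradient θ x‖ ^ 2)⁻¹ * ⟪serrinFlow θ a s x, gradient θ x⟫ :=
      funext (amp_eq_inner_serrinFlow hx a)
    rw [e]
    exact (h.inner ℝ (differentiableAt_const _)).const_mul _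
  · show DifferentiableAt ℝ (fun s => a s • gradient θ x) t
    exact h.smul (differentiableAt_const _)

/-! ## Positive side: smooth amplitudes give classical solutions -/

/-- For a `C^∞` amplitude `a` and a `C^∞` globally harmonic `θ`, Serrin's pair IS a classical Navier–Stokes solution
on `ℝ × ℝ³` with zero force, for every viscosity `ν` (pressure built with `a' = deriv a`).
[cite: Serrin1962, the example u = a(t)∇h] -/
theorem isClassicalNSSolutionOn_serrinFlow {θ : ℝ³ → ℝ} (hθ : ContDiff ℝ ∞ θ) (hΔ : ∀ x, Δ θ x = 0) {a : ℝ → ℝ}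
    (ha : ContDiff ℝ ∞ a) (ν : ℝ) :
    IsClassicalNSSolutionOn univ ν 0 (serrinFlow θ a) (serrinPressure θ a (deriv a)) := by
  have hg : ContDiff ℝ ∞ (gradient θ) := contDiff_gradient_of_top' hθ
  have ha' : ContDiff ℝ ∞ (deriv a) := (contDiff_infty_iff_deriv.1 ha).2
  refine ⟨?_, ?_, ?_, ?_⟩
  · -- joint smoothness of `(t, x) ↦ a t • ∇θ x`
    have : ContDiff ℝ ∞ (uncurry (serrinFlow θ a)) := by
      have e : uncurry (serrinFlow θ a) = fun z : ℝ × ℝ³ => a z.1 • gradient θ z.2 := by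
        funext z; rfl
      rw [e]
      exact (ha.comp contDiff_fst).smul (hg.comp contDiff_snd)
    exact this.contDiffOn
  · have : ContDiff ℝ ∞ (uncurry (serrinPressure θ a (deriv a))) := by
      have e : uncurry (serrinPressure θ a (deriv a)) =
          fun z : ℝ × ℝ³ => -(deriv a z.1) * θ z.2 - (a z.1) ^ 2 * (2⁻¹ * ‖gradient θ z.2‖ ^ 2) := by
        funext z; rfl
      rw [e]
      exact ((ha'.comp contDiff_fst).neg.mul (hθ.comp contDiff_snd)).sub
        (((ha.comp contDiff_fst).pow 2).mul (contDiff_const.mul ((hg.comp contDiff_snd).norm_sq ℝ)))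
    exact this.contDiffOn
  · intro t _ x
    have hθ3 : ContDiff ℝ 3 θ := hθ.of_le (by norm_cast)
    have hat : HasDerivAt a (deriv a t) t := ((contDiff_infty_iff_deriv.1 ha).1 t).hasDerivAt
    have hm := serrinFlow_momentum hθ3 hΔ hat ν x
    rw [timeDerivWithin_apply, derivWithin_univ]
    simpa only [Pi.zero_apply, add_zero] using hm
  · intro t _
    exact isDivFree_serrinFlow (hθ.of_le (by norm_cast)) hΔ a t

/-! ## Negative side: no time regularity beyond that of `a` -/

/-- A jointly smooth field has `C^∞` time lines `s ↦ w s x` at interior times (compose with `s ↦ (s, x)`).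
[folklore] -/
private theorem IsSmoothSpaceTimeOn.contDiffAt_time {S : Set ℝ} {w : ℝ → ℝ³ → ℝ³} (h : IsSmoothSpaceTimeOn S w)
    {t : ℝ} (ht : S ∈ 𝓝 t) (x : ℝ³) : ContDiffAt ℝ ∞ (fun s => w s x) t := by
  have h1 : ContDiffWithinAt ℝ ∞ (uncurry w) (S ×ˢ univ) (t, x) :=
    h (t, x) (mk_mem_prod (mem_of_mem_nhds ht) (mem_univ x))
  have h1' : ContDiffAt ℝ ∞ (uncurry w) (t, x) :=
    h1.contDiffAt (prod_mem_nhds ht univ_mem)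
  have h2 : ContDiffAt ℝ ∞ (fun s : ℝ => ((s, x) : ℝ × ℝ³)) t := contDiffAt_id.prodMk contDiffAt_const
  exact h1'.comp t h2

/-- **No time regularity from the equations.** If the amplitude `a` is not `C^∞` at `t₀` and `∇θ(x₀) ≠ 0`, then the
exact solution `u = a∇θ` is not jointly smooth on any time set that is a neighbourhood of `t₀` — even though, whenever
`a` is differentiable, it satisfies the Navier–Stokes system at every point (`serrinFlow_momentum`,
`isDivFree_serrinFlow`) and is `C^∞` in `x` (`contDiff_serrinFlow_space`).
[cite: RobinsonRodrigoSadowski2016, Example 13.2] -/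
theorem not_isSmoothSpaceTimeOn_serrinFlow {θ : ℝ³ → ℝ} {x₀ : ℝ³} (hx : gradient θ x₀ ≠ 0) {a : ℝ → ℝ}
    {t₀ : ℝ} (ha : ¬ ContDiffAt ℝ ∞ a t₀) {S : Set ℝ} (hS : S ∈ 𝓝 t₀) :
    ¬ IsSmoothSpaceTimeOn S (serrinFlow θ a) := fun h =>
  ha ((contDiffAt_serrinFlow_time_iff hx a t₀ _).1 (h.contDiffAt_time hS x₀))

/-- Hence, under the same hypotheses, `u = a∇θ` is not a classical Navier–Stokes solution on such a time set for ANY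
pressure, force and viscosity (classical solutions are jointly smooth by definition).
[cite: RobinsonRodrigoSadowski2016, Example 13.2] -/
theorem not_isClassicalNSSolutionOn_serrinFlow {θ : ℝ³ → ℝ} {x₀ : ℝ³} (hx : gradient θ x₀ ≠ 0) {a : ℝ → ℝ}
    {t₀ : ℝ} (ha : ¬ ContDiffAt ℝ ∞ a t₀) {S : Set ℝ} (hS : S ∈ 𝓝 t₀) (ν : ℝ) (f : ℝ → ℝ³ → ℝ³)
    (p : ℝ → ℝ³ → ℝ) : ¬ IsClassicalNSSolutionOn S ν f (serrinFlow θ a) p := fun h =>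
  not_isSmoothSpaceTimeOn_serrinFlow hx ha hS h.smooth_velocity

/-! ## A concrete witness: `a(t) = t|t|`, `θ(x) = x₀` -/

/-- The cusp amplitude `a(t) = t|t|`: `C¹` on `ℝ`, not `C²` at `0`. [folklore] -/
def cuspAmp (t : ℝ) : ℝ := t * |t|

/-- Its derivative `a'(t) = 2|t|`. [folklore] -/
def cuspAmpDeriv (t : ℝ) : ℝ := 2 * |t|

/-- `a(t) = t|t|` is differentiable at every `t` with derivative `2|t|` (product rule off `0`; at `0` the
difference quotient is `|h| → 0`). [folklore] -/
private theorem hasDerivAt_cuspAmp (t : ℝ) : HasDerivAt cuspAmp (cuspAmpDeriv t) t := by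
  rcases lt_trichotomy t 0 with ht | rfl | ht
  · have h := (hasDerivAt_id t).mul (hasDerivAt_abs_neg ht)
    have e : (1 : ℝ) * |t| + id t * (-1) = cuspAmpDeriv t := by
      simp only [id, cuspAmpDeriv, abs_of_neg ht]; ring
    rw [e] at h
    exact h
  · rw [hasDerivAt_iff_isLittleO_nhds_zero]
    simp only [cuspAmp, cuspAmpDeriv, abs_zero, mul_zero, zero_add, sub_zero, smul_eq_mul]
    refine Asymptotics.isLittleO_iff.2 fun c hc => ?_
    filter_upwards [Metric.ball_mem_nhds (0 : ℝ) hc] with h hh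
    rw [Metric.mem_ball, dist_zero_right, Real.norm_eq_abs] at hh
    rw [Real.norm_eq_abs, Real.norm_eq_abs, abs_mul, abs_abs, mul_comm]
    exact mul_le_mul_of_nonneg_right hh.le (abs_nonneg h)
  · have h := (hasDerivAt_id t).mul (hasDerivAt_abs_pos ht)
    have e : (1 : ℝ) * |t| + id t * 1 = cuspAmpDeriv t := by
      simp only [id, cuspAmpDeriv, abs_of_pos ht]; ring
    rw [e] at h
    exact h

/-- `deriv a = 2|·|`. [folklore] -/
private theorem deriv_cuspAmp : deriv cuspAmp = cuspAmpDeriv := funext fun t => (hasDerivAt_cuspAmp t).deriv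

/-- `a(t) = t|t|` is NOT `C²` at `0`: otherwise `deriv a = 2|·|` would be differentiable at `0`
(Mathlib `not_differentiableAt_abs_zero`). [folklore] -/
private theorem not_contDiffAt_two_cuspAmp : ¬ ContDiffAt ℝ 2 cuspAmp 0 := by
  intro h
  -- `C²` at `0` ⇒ `C²` on an open neighbourhood ⇒ `deriv` is `C¹` there ⇒ differentiable at `0`
  obtain ⟨U, hU, hcd⟩ := h.contDiffOn (m := 2) le_rfl (by simp)
  obtain ⟨V, hVU, hVo, hV0⟩ := mem_nhds_iff.1 hU
  have hV : ContDiffOn ℝ 2 cuspAmp V := hcd.mono hVU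
  have hd : ContDiffOn ℝ 1 (deriv cuspAmp) V := by
    have := hV.deriv_of_isOpen hVo (m := 1) (by norm_num)
    exact this
  have hdiff : DifferentiableAt ℝ (deriv cuspAmp) 0 :=
    (hd.differentiableOn one_ne_zero).differentiableAt (hVo.mem_nhds hV0)
  rw [deriv_cuspAmp] at hdiff
  have habs : DifferentiableAt ℝ (fun t : ℝ => |t|) 0 := by
    have e : (fun t : ℝ => |t|) = fun t => (2 : ℝ)⁻¹ * cuspAmpDeriv t := by
      funext t; simp only [cuspAmpDeriv]; ring
    rw [e]
    exact hdiff.const_mul _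
  exact not_differentiableAt_abs_zero habs

/-- Hence `a = t|t|` is not `C^∞` at `0`. [folklore] -/
private theorem not_contDiffAt_top_cuspAmp : ¬ ContDiffAt ℝ ∞ cuspAmp 0 := fun h =>
  not_contDiffAt_two_cuspAmp (h.of_le (by norm_cast))

/-- The harmonic coordinate potential `θ(x) = x₀`. [folklore] -/
def coordZero (x : ℝ³) : ℝ := x 0

/-- `θ = x₀` is the continuous linear functional `proj 0`. [folklore] -/
private theorem coordZero_eq : coordZero = ⇑(EuclideanSpace.proj (𝕜 := ℝ) (0 : Fin 3)) := rfl

/-- `θ = x₀` is `C^∞`. [folklore] -/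
private theorem contDiff_coordZero {n : WithTop ℕ∞} : ContDiff ℝ n coordZero := by
  rw [coordZero_eq]; exact (EuclideanSpace.proj (𝕜 := ℝ) (0 : Fin 3)).contDiff

/-- `∇x₀ = e₀` at every point. [folklore] -/
private theorem gradient_coordZero (x : ℝ³) : gradient coordZero x = EuclideanSpace.single 0 1 := by
  show (InnerProductSpace.toDual ℝ ℝ³).symm (fderiv ℝ coordZero x) = _
  rw [coordZero_eq, ContinuousLinearMap.fderiv]
  apply (InnerProductSpace.toDual ℝ ℝ³).injective
  rw [LinearIsometryEquiv.apply_symm_apply]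
  ext y
  rw [InnerProductSpace.toDual_apply_apply, EuclideanSpace.inner_single_left]
  simp

/-- `∇x₀ ≠ 0`. [folklore] -/
private theorem gradient_coordZero_ne_zero (x : ℝ³) : gradient coordZero x ≠ 0 := by
  rw [gradient_coordZero]
  intro h
  have := congrArg (fun v : ℝ³ => v 0) h
  simp at this

/-- `Δx₀ = 0`: the second derivative of a linear functional vanishes. [folklore] -/
private theorem laplacian_coordZero (x : ℝ³) : Δ coordZero x = 0 := by
  rw [InnerProductSpace.laplacian_eq_iteratedFDeriv_stdOrthonormalBasis]
  refine Finset.sum_eq_zero fun i _ => ?_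
  have h1 : fderiv ℝ coordZero = fun _ => EuclideanSpace.proj (𝕜 := ℝ) (0 : Fin 3) := by
    funext y; rw [coordZero_eq, ContinuousLinearMap.fderiv]
  rw [iteratedFDeriv_two_apply, h1]
  simp

/-- **The witness satisfies Navier–Stokes at EVERY point of `ℝ × ℝ³`** (zero force, any `ν`): momentum equation
for `u = t|t| e₀`, `p = −2|t| x₀ − t⁴/2`. [cite: Serrin1962, the example u = a(t)∇h] -/
theorem serrinWitness_momentum (ν t : ℝ) (x : ℝ³) :
    deriv (fun s => serrinFlow coordZero cuspAmp s x) t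
        + convect (serrinFlow coordZero cuspAmp t) (serrinFlow coordZero cuspAmp t) x =
      ν • Δ (serrinFlow coordZero cuspAmp t) x - gradient (serrinPressure coordZero cuspAmp cuspAmpDeriv t) x :=
  serrinFlow_momentum contDiff_coordZero laplacian_coordZero (hasDerivAt_cuspAmp t) ν x

/-- The witness is divergence-free at every time. [cite: Serrin1962, the example u = a(t)∇h] -/
theorem serrinWitness_divergence (t : ℝ) : VectorCalculus.IsDivFree (serrinFlow coordZero cuspAmp t) :=
  isDivFree_serrinFlow contDiff_coordZero laplacian_coordZero cuspAmp t

/-- The witness is `C^∞` in space at every time. [cite: RobinsonRodrigoSadowski2016, Example 13.2] -/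
theorem serrinWitness_contDiff_space (t : ℝ) : ContDiff ℝ ∞ (serrinFlow coordZero cuspAmp t) :=
  contDiff_serrinFlow_space contDiff_coordZero cuspAmp t

/-- … and NOT `C²` in time at `t = 0` (at any point `x`). [cite: RobinsonRodrigoSadowski2016, Example 13.2] -/
theorem serrinWitness_not_contDiffAt_two (x : ℝ³) :
    ¬ ContDiffAt ℝ 2 (fun s => serrinFlow coordZero cuspAmp s x) 0 := fun h =>
  not_contDiffAt_two_cuspAmp ((contDiffAt_serrinFlow_time_iff (gradient_coordZero_ne_zero x) cuspAmp 0 2).1 h)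

/-- … hence not a classical solution on any time set around `0`, for any pressure, force and viscosity, although it
satisfies the system pointwise everywhere. [cite: RobinsonRodrigoSadowski2016, Example 13.2] -/
theorem serrinWitness_not_classical {S : Set ℝ} (hS : S ∈ 𝓝 (0 : ℝ)) (ν : ℝ) (f : ℝ → ℝ³ → ℝ³)
    (p : ℝ → ℝ³ → ℝ) : ¬ IsClassicalNSSolutionOn S ν f (serrinFlow coordZero cuspAmp) p :=
  not_isClassicalNSSolutionOn_serrinFlow (gradient_coordZero_ne_zero 0) not_contDiffAt_top_cuspAmp hS ν f p

end Literature.Analysis.FluidPDE
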